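import Summits.KontsevichZagierPeriods.Zeta5Search.LaiSweepShard

/-!
# `κ₃` sweep certificate — shard file 087 of 127 (shards 609–615 of 889)

HONEST FRAMING. Systematic search; no irrationality claim unless certified. This file only checks,
by `decide +kernel`, shards 609–615 of the order-cell sweep of the `κ₃` point `(74, 2180, 444; δ74)`
(engine `LaiSweepEngine`, soundness `LaiSweepJump/Free/Eval/Shard/Kappa3`; a shard is `⟨regime, n,
p, q, p', q', Lo, Up⟩`: `n` cells from `p/q` to `p'/q'` with integer rate sums in `[Lo, Up]`, `K =
128`, `D = 2^40`). It draws NO conclusion: only the capstone `LaiKappa3SweepCert`, which needs all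
127 shard files, does. Kernel cost of this file ≈ 560 cells × 0.3 s.
-/

namespace Summit.KontsevichZagierPeriods.Zeta5Search.Sweep

set_option maxHeartbeats 100000000 in
/-- Shard 609: 80 cells of regime B from `35/54` to `163/251`.
[cite: Lai2024BallRivoal, §4 Lemma 4.3] -/
theorem shard609 :
    Shard.check 128 (2^40)
      ⟨true, 80, 35, 54, 163, 251, 12591065544290, 17253494413705⟩ = true := by
  decide +kernel

set_option maxHeartbeats 100000000 in
/-- Shard 610: 80 cells of regime B from `163/251` to `95/146`.
[cite: Lai2024BallRivoal, §4 Lemma 4.3] -/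
theorem shard610 :
    Shard.check 128 (2^40)
      ⟨true, 80, 163, 251, 95, 146, 12859762942261, 17640227739220⟩ = true := by
  decide +kernel

set_option maxHeartbeats 100000000 in
/-- Shard 611: 80 cells of regime B from `95/146` to `191/293`.
[cite: Lai2024BallRivoal, §4 Lemma 4.3] -/
theorem shard611 :
    Shard.check 128 (2^40)
      ⟨true, 80, 95, 146, 191, 293, 11941443997126, 16397122798615⟩ = true := by
  decide +kernel

set_option maxHeartbeats 100000000 in
/-- Shard 612: 80 cells of regime B from `191/293` to `258/395`.
[cite: Lai2024BallRivoal, §4 Lemma 4.3] -/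
theorem shard612 :
    Shard.check 128 (2^40)
      ⟨true, 80, 191, 293, 258, 395, 12877279448998, 17700387413219⟩ = true := by
  decide +kernel

set_option maxHeartbeats 100000000 in
/-- Shard 613: 80 cells of regime B from `258/395` to `89/136`.
[cite: Lai2024BallRivoal, §4 Lemma 4.3] -/
theorem shard613 :
    Shard.check 128 (2^40)
      ⟨true, 80, 258, 395, 89, 136, 12453880366702, 17136239810627⟩ = true := by
  decide +kernel

set_option maxHeartbeats 100000000 in
/-- Shard 614: 80 cells of regime B from `89/136` to `179/273`.
[cite: Lai2024BallRivoal, §4 Lemma 4.3] -/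
theorem shard614 :
    Shard.check 128 (2^40)
      ⟨true, 80, 89, 136, 179, 273, 12626244416259, 17391443781935⟩ = true := by
  decide +kernel

set_option maxHeartbeats 100000000 in
/-- Shard 615: 80 cells of regime B from `179/273` to `157/239`.
[cite: Lai2024BallRivoal, §4 Lemma 4.3] -/
theorem shard615 :
    Shard.check 128 (2^40)
      ⟨true, 80, 179, 273, 157, 239, 12217061731736, 16845136112445⟩ = true := by
  decide +kernel

/-- The checked shards of this file, in order. [folklore] -/
def shards087 : List (CheckedShard 128 (2^40)) :=
  [⟨_, shard609⟩, ⟨_, shard610⟩, ⟨_, shard611⟩, ⟨_, shard612⟩, ⟨_, shard613⟩,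
    ⟨_, shard614⟩, ⟨_, shard615⟩]

end Summit.KontsevichZagierPeriods.Zeta5Search.Sweep
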